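import Summits.BirchSwinnertonDyer.Rank1Residual.GaloisImage.KatoAvatarComponents
import Summits.BirchSwinnertonDyer.Rank1Residual.GaloisImage.KatoEulerFactorNormalisation
import HarnessLib

/-!
# The `n`-normalised Kato avatar is an Euler-factor family generated from the Mazur–Tate datum
# (hypothesis `hX` of PK-4b-C3 for the Kato side)
# (cell `b2b-bsdres`, team n1011, ROUTE-1 PORT anatomy (P-KIM); R1-71/R1-72: PK-4b
# `KatoZetaValueDerivativeCongruence`, layer PK-4b-C4b-2 (ii); seat p15 GEN 10)

HONEST FRAMING (cell `b2b-bsdres`, run/shared/lean/b2b/bsd-rank1-residual/, verbatim in every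
file): the goal of the cell is to DELETE the COMBINATION-SHAPED residual classes of the
Birch–Swinnerton-Dyer formula for ALL analytic-rank `≤ 1` elliptic curves over `ℚ` — "full BSD
formula for every rank `≤ 1` curve in class `C`" assembled STRICTLY from published theorems — so
that the rank-`≤ 1` remainder becomes exactly the CONSTRUCTION-SHAPED classes, which are TYPED
(missing-input `Prop`s), NOT attempted. This is not "finishing BSD". Team n1011 (N10/N11; ROUTE 1,
the PORT anatomy (P-KIM) of class X4 ∧ `p = 3`): research route on CONSTRUCTION-SHAPED classes;
prove what is provable now; no claim beyond stated classes; census output = EVIDENCE, never a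
Literature fact; RESIDUAL-MAP marks UNCHANGED; nothing is booked by this file. TOOL THEOREMS ONLY:
no definition, no named fact, no instance, no `sorry`; Kato's value law enters as a DISPLAYED
hypothesis `hval` (the literal conclusion shape of PK-4a `ZetaValueCharSum.charSum_eq_of_even`,
which discharges it from `ZetaBody` at `n = cycLevel p 0 r`, `M = p·A`).

## What

`n = ∏_i ℓ_i` distinct primes `∤ N`, `G = (ℤ/n)ˣ`. §4 ★ `lift_avatar_eq_of_even`: if `x ∈ ℚ(ζ_n)` has
the character sums of PK-4a at every even primitive character (`hval`, depletion modulus `n·M`,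
`(M, n) = 1`, cusp data `c, d, a, A, d′`, embedding normalised by `ι_n(ζ_n) = e(u/n)`) and `X ∈ ℚ[G]`
is its avatar (`x = Σ_g X_g σ_g ζ_n`, T-PKEV E-D), then for every EVEN `ψ` (conductor `n₀`, primitive `ψ₀`)
`n · ψ(X) = κ · ψ(u⁻¹) · (∏_{ℓ_i ∤ n₀} (a_i − ψ₀⁻¹(ℓ_i) − ℓ_i ψ₀(ℓ_i))) · (∏_{q ∣ M} E_q(ψ₀⁻¹)) · R⁻_ψ · Σ_b ψ₀(b)[b/n₀]⁺`
(E-D `lift_eq_charSum_div_charSum_zeta` + F-A `charSum_zeta_eq_inv_mul_gaussSum` + C4b-2a: the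
Gauss-sum quotient `n/(τ(ψ₀) τ_n(ψ̄)) = (n/n₀) μ(n/n₀) ψ₀(n/n₀)` converts the depleted Euler factors at
the `ℓ_i ∤ n₀` into the `n`-NORMALISED Kato factors `a_i − ψ₀⁻¹(ℓ_i) − ℓ_i ψ₀(ℓ_i)` — to be compared
with the Mazur–Tate factors `a_i − ψ₀(ℓ_i) − ψ₀⁻¹(ℓ_i)`; the difference is `(1 − ℓ_i) ψ₀(ℓ_i)`).
§5 ★★ `mapRingHom_plusAvatar_eq_family`: hence in `ℂ[G]`
`((1 + δ₋₁) · n · X)^ℂ = (∏_i (e_i K_i + 1 − e_i)) · B`, `B = (1 + δ₋₁) κ δ_{u⁻¹} E C⁻ Θ̂`, `Θ̂` the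
Mazur–Tate datum of PK-4b-C4b-1 — the hypothesis `hX` of PK-4b-C3
`prod_deriv_mul_sub_eq_sum_of_generated`, by Fourier injectivity (C1) and the component formulas of
`KatoAvatarComponents` (odd characters kill both sides through `1 + ψ(−1) = 0`).
HONEST LIMITS: bookkeeping over ℂ; `hval` displayed, never proved here; no integrality; closes nothing.

References: K. Kato, Astérisque 295 (2004) Thm. 6.6 (1) p. 163, §6.2 p. 161 [Kato2004Asterisque];
H. L. Montgomery, R. C. Vaughan, Acta Arith. 27 (1975) Lemma 5.2 [MontgomeryVaughanActa1975]; K. Ota,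
arXiv:1509.00682 Prop. 2.3 (1) [Ota2018]; K. Rubin, *Euler Systems* (2000) §9.6; r1 ROUTE-1 §55–57
(cells/n1011/ROUTE-1.md); `HOME/b2b-bsdres-n1011-p15/g9/pk4/PK4b-C4-DESIGN.md`.
-/

noncomputable section

namespace Summit.BirchSwinnertonDyer.Rank1Residual.GaloisImage

namespace EulerFactorComparison

open Finset MonoidAlgebra
open scoped BigOperators
open Literature.NumberTheory.EllipticCurves Literature.NumberTheory.EllipticCurves.ModularForms
open Literature.NumberTheory.EllipticCurves.Kato2004.EulerSystemValues
open CongruenceSubgroup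

/-! ### §4 ★ The `n`-normalised components of Kato's avatar at an even character -/

section Avatar

variable {ι : Type*} [Fintype ι] [DecidableEq ι] (ℓ : ι → ℕ) [hℓ : ∀ i, Fact (ℓ i).Prime]
  (hinj : Function.Injective ℓ) {n : ℕ} [NeZero n] (hn : ∏ i, ℓ i = n)
  {N : ℕ} (f : CuspForm (Gamma0 N) 2)

set_option backward.isDefEq.respectTransparency false in
include hinj hn in
/-- **★ The `n`-normalised components of Kato's avatar.** Let `x ∈ ℚ(ζ_n)` have the character sums
of PK-4a at every EVEN primitive character (`hval`: the conclusion shape of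
`ZetaValueCharSum.charSum_eq_of_even` with depletion modulus `n·M`, `(M, n) = 1`, cusp data
`c, d, a, A, d′`, embedding `ι_n` normalised by `ι_n(ζ_n) = e(u/n)`), and let `X ∈ ℚ[(ℤ/n)ˣ]` be its
avatar (`x = Σ_g X_g σ_g ζ_n`). Then for every EVEN `ψ` mod `n` (conductor `n₀`, primitive `ψ₀`):
`n · ψ(X) = κ · ψ(u⁻¹) · (∏_{ℓ_i ∤ n₀} (a_i − ψ₀⁻¹(ℓ_i) − ℓ_i ψ₀(ℓ_i))) · (∏_{q ∣ M} E_q(ψ₀⁻¹)) · R⁻_ψ ·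
Σ_{b mod n₀} ψ₀(b)[b/n₀]⁺` — the Gauss-sum quotient `n/(τ(ψ₀) τ_n(ψ̄)) = (n/n₀) μ(n/n₀) ψ₀(n/n₀)`
(C4b-2a) converts the depleted Euler factors at the `ℓ_i ∤ n₀` into the `n`-NORMALISED Kato factors.
[cite: Kato2004Asterisque, Thm. 6.6 (1) (p. 163) and §6.2 (p. 161)]
[cite: MontgomeryVaughanActa1975, §5 Lemma 5.2] -/
theorem lift_avatar_eq_of_even (hℓN : ∀ i, ¬ ℓ i ∣ N)
    (x : CyclotomicField n ℚ) (X : MonoidAlgebra ℚ (ZMod n)ˣ)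
    (hxX : x = ∑ g : (ZMod n)ˣ, X.coeff g •
      sigma n g (IsCyclotomicExtension.zeta n ℚ (CyclotomicField n ℚ)))
    (ιe : CyclotomicField n ℚ →+* ℂ) (u : (ZMod n)ˣ)
    (hι : ιe (IsCyclotomicExtension.zeta n ℚ (CyclotomicField n ℚ)) =
      Complex.exp (2 * Real.pi * Complex.I * ((u : ZMod n).val : ℂ) / n))
    (κ : ℂ) {M : ℕ} (hM0 : M ≠ 0) (hM : M.Coprime n) (c d a : ℤ) (A : ℕ) (d' : ℤ)
    (hval : ∀ {n₀ : ℕ} [NeZero n₀] (hn₀ : n₀ ∣ n) {χ₀ : DirichletCharacter ℂ n₀},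
      χ₀.IsPrimitive → χ₀ (-1) = 1 →
      charSum n ιe (DirichletCharacter.changeLevel hn₀ χ₀) x =
        κ * ((∏ q ∈ (n * M).primeFactors.filter (fun q => ¬ q ∣ n₀),
            (1 - χ₀ (q : ZMod n₀) * cuspCoeff f q * (q : ℂ) ^ (-(1 : ℂ)) +
              (if q ∣ N then 0 else (q : ℂ)) * χ₀ (q : ZMod n₀) ^ 2 * ((q : ℂ) ^ (-(1 : ℂ))) ^ 2)) *
          ((∑ b : ZMod n₀, χ₀⁻¹ b * ((ratPlusSymbol f ((b.val : ℚ) / n₀) : ℚ) : ℂ)) /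
            gaussSum χ₀⁻¹ (ZMod.stdAddChar (N := n₀)))) *
        cuspFactor f true (fun j => (DirichletCharacter.changeLevel hn₀ χ₀)⁻¹ (j : ZMod n)) c d a A d')
    (ψ : DirichletCharacter ℂ n) (heven : ψ.Even) :
    haveI : NeZero ψ.conductor := ⟨ψ.conductor_ne_zero⟩
    (n : ℂ) * MonoidAlgebra.lift ℚ ℂ (ZMod n)ˣ ((Units.coeHom ℂ).comp ψ.toUnitHom) X =
      κ * ψ ((u⁻¹ : (ZMod n)ˣ) : ZMod n) *
        (∏ i ∈ univ.filter (fun i => ¬ ℓ i ∣ ψ.conductor),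
          (cuspCoeff f (ℓ i) - (ψ.primitiveCharacter)⁻¹ (ℓ i : ZMod ψ.conductor) -
            (ℓ i : ℂ) * ψ.primitiveCharacter (ℓ i : ZMod ψ.conductor))) *
        (∏ q ∈ M.primeFactors,
          (1 - (ψ.primitiveCharacter)⁻¹ (q : ZMod ψ.conductor) * cuspCoeff f q * (q : ℂ) ^ (-(1 : ℂ)) +
            (if q ∣ N then 0 else (q : ℂ)) * (ψ.primitiveCharacter)⁻¹ (q : ZMod ψ.conductor) ^ 2 *
              ((q : ℂ) ^ (-(1 : ℂ))) ^ 2)) *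
        cuspFactor f true (fun j => ψ (j : ZMod n)) c d a A d' *
        ∑ b : ZMod ψ.conductor, ψ.primitiveCharacter b *
          ((ratPlusSymbol f ((b.val : ℚ) / ψ.conductor) : ℚ) : ℂ) := by
  classical
  haveI : NeZero ψ.conductor := ⟨ψ.conductor_ne_zero⟩
  have hsq : Squarefree n := squarefree_of_prod_eq ℓ hinj hn
  have heven1 : ψ (-1) = 1 := heven
  have hψinv := inv_eq_changeLevel_primitiveCharacter_inv ψ
  have hprim : (ψ.primitiveCharacter)⁻¹.IsPrimitive := by
    rw [DirichletCharacter.isPrimitive_def, DirichletCharacter.conductor_inv]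
    exact ψ.primitiveCharacter_isPrimitive
  have heven₀ : (ψ.primitiveCharacter)⁻¹ (-1) = 1 := by
    rw [MulChar.inv_apply_eq_inv', primitiveCharacter_neg_one, heven1, inv_one]
  -- E-D: the component of the avatar
  have hX := GroupRingEval.lift_eq_charSum_div_charSum_zeta n hsq ιe ψ⁻¹ X hxX
  rw [inv_inv] at hX
  -- the value law at `χ₀ = ψ₀⁻¹`
  have hx := hval ψ.conductor_dvd_level hprim heven₀
  rw [← hψinv, inv_inv, inv_inv] at hx
  -- the character sum of `ζ_n` (F-A)
  have hζ := CharSum.charSum_zeta_eq_inv_mul_gaussSum n ιe ψ⁻¹ u hι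
  rw [inv_inv] at hζ
  -- the Gauss-sum quotient (C4b-2a)
  obtain ⟨hμ, hcop⟩ := GroupRingEval.moebius_div_ne_zero_and_coprime_of_squarefree n hsq ψ.conductor_dvd_level
  have hA := div_gaussSum_mul_gaussSum_changeLevel_eq ψ.conductor_dvd_level hprim (by exact_mod_cast hμ) hcop
  rw [← hψinv, inv_inv, heven₀, one_mul, div_eq_prod_filter_not_dvd ℓ hinj hn ψ.conductor_dvd_level] at hA
  -- the Euler factors at the `ℓ_i ∤ n₀` become the `n`-normalised Kato factors
  set T : Finset ι := univ.filter (fun i => ¬ ℓ i ∣ ψ.conductor) with hT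
  have hD := prod_mul_moebius_mul_inv_apply_mul_prod_eq ℓ hinj T (ψ.primitiveCharacter)⁻¹
    (fun i => 1 - (ψ.primitiveCharacter)⁻¹ (ℓ i : ZMod ψ.conductor) * cuspCoeff f (ℓ i) * (ℓ i : ℂ) ^ (-(1 : ℂ)) +
      (if ℓ i ∣ N then 0 else (ℓ i : ℂ)) * (ψ.primitiveCharacter)⁻¹ (ℓ i : ZMod ψ.conductor) ^ 2 *
        ((ℓ i : ℂ) ^ (-(1 : ℂ))) ^ 2)
  rw [inv_inv] at hD
  have hE : ∀ i ∈ T, -(ℓ i : ℂ) * ψ.primitiveCharacter (ℓ i : ZMod ψ.conductor) *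
      (1 - (ψ.primitiveCharacter)⁻¹ (ℓ i : ZMod ψ.conductor) * cuspCoeff f (ℓ i) * (ℓ i : ℂ) ^ (-(1 : ℂ)) +
        (if ℓ i ∣ N then 0 else (ℓ i : ℂ)) * (ψ.primitiveCharacter)⁻¹ (ℓ i : ZMod ψ.conductor) ^ 2 *
          ((ℓ i : ℂ) ^ (-(1 : ℂ))) ^ 2) =
      cuspCoeff f (ℓ i) - (ψ.primitiveCharacter)⁻¹ (ℓ i : ZMod ψ.conductor) -
        (ℓ i : ℂ) * ψ.primitiveCharacter (ℓ i : ZMod ψ.conductor) := fun i hi => by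
    have hi' : ¬ ℓ i ∣ ψ.conductor := (Finset.mem_filter.mp hi).2
    have h := neg_mul_mul_eulerFactor_eq (hℓN i) (by exact_mod_cast (hℓ i).out.ne_zero : (ℓ i : ℂ) ≠ 0)
      (ψ.primitiveCharacter)⁻¹ (cuspCoeff f (ℓ i))
      (apply_mul_inv_apply_eq_one _ ((Nat.Prime.coprime_iff_not_dvd (hℓ i).out).mpr hi'))
    rw [inv_inv] at h
    exact h
  rw [Finset.prod_congr rfl hE] at hD
  -- the product over the primes of `n·M` not dividing `n₀` splits
  rw [prod_filter_primeFactors_mul_eq ℓ hinj hn hM0 hM ψ.conductor_dvd_level] at hx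
  -- nonvanishing
  have hτ₁ : gaussSum ψ.primitiveCharacter (ZMod.stdAddChar (N := ψ.conductor)) ≠ 0 :=
    gaussSum_stdAddChar_ne_zero_of_isPrimitive ψ.primitiveCharacter_isPrimitive
  have hτn : gaussSum ψ⁻¹ (ZMod.stdAddChar (N := n)) ≠ 0 := GroupRingEval.gaussSum_ne_zero_of_squarefree n hsq ψ⁻¹
  have hu : ψ ((u⁻¹ : (ZMod n)ˣ) : ZMod n) * ψ (u : ZMod n) = 1 := by
    rw [← map_mul, ← Units.val_mul, inv_mul_cancel, Units.val_one, map_one]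
  have hψu : ψ (u : ZMod n) ≠ 0 := fun h0 => by rw [h0, mul_zero] at hu; exact zero_ne_one hu
  have hu' : ψ ((u⁻¹ : (ZMod n)ˣ) : ZMod n) = (ψ (u : ZMod n))⁻¹ := eq_inv_of_mul_eq_one_left hu
  -- assemble
  have hKT : (n : ℂ) / (gaussSum ψ.primitiveCharacter (ZMod.stdAddChar (N := ψ.conductor)) *
      gaussSum ψ⁻¹ (ZMod.stdAddChar (N := n))) *
      ∏ i ∈ T, (1 - (ψ.primitiveCharacter)⁻¹ (ℓ i : ZMod ψ.conductor) * cuspCoeff f (ℓ i) * (ℓ i : ℂ) ^ (-(1 : ℂ)) +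
        (if ℓ i ∣ N then 0 else (ℓ i : ℂ)) * (ψ.primitiveCharacter)⁻¹ (ℓ i : ZMod ψ.conductor) ^ 2 *
          ((ℓ i : ℂ) ^ (-(1 : ℂ))) ^ 2) =
      ∏ i ∈ T, (cuspCoeff f (ℓ i) - (ψ.primitiveCharacter)⁻¹ (ℓ i : ZMod ψ.conductor) -
        (ℓ i : ℂ) * ψ.primitiveCharacter (ℓ i : ZMod ψ.conductor)) := by
    rw [hA, ← hD, Nat.cast_prod]
  rw [hX, hx, hζ, hu']
  rw [← hKT]
  field_simp
  ring

/-! ### §5 ★★ The scaled plus-avatar is a generated Euler-factor family (`hX` of PK-4b-C3) -/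

set_option backward.isDefEq.respectTransparency false in
include hinj hn in
/-- **★★ `hX`: the complexified scaled plus-avatar of Kato's value is generated from the Mazur–Tate
datum with the `n`-normalised Kato factors.** With the data of `lift_avatar_eq_of_even` (value law
`hval` DISPLAYED), integral Hecke eigenvalues `a_i = a_{ℓ_i}(f)`, lifts `λ_i ↦ ℓ_i`, the norm /
projector elements `N_j`, `e_j = (ℓ_j − 1)⁻¹ N_j` and ANY local factors `M_j` of the modular side, and a
datum `Θ̂` generating the pull-backs of `θ̃_f(n_d)` (PK-4b-C4b-1 `exists_pullback_eq_family`):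
`((1 + δ₋₁) · n · X)^ℂ = (∏_i (e_i K_i + (1 − e_i))) · ((1 + δ₋₁) · κδ_{u⁻¹} · E · C⁻ · Θ̂)`
in `ℂ[(ℤ/n)ˣ]`, `K_i = a_i − δ_{λ_i⁻¹} − ℓ_i δ_{λ_i}` — by Fourier injectivity (C1): at an even `ψ`
both sides are `2 ×` the two sides of `lift_avatar_eq_of_even`, at an odd `ψ` both vanish through
`1 + ψ(−1) = 0`. This is the hypothesis `hX` of PK-4b-C3 `prod_deriv_mul_sub_eq_sum_of_generated`
with `B = (1 + δ₋₁) κ δ_{u⁻¹} E C⁻ Θ̂`; the matching `hY` is C4b-1's identity multiplied by the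
same commuting factor. [cite: Kato2004Asterisque, Thm. 6.6 (1) (p. 163) and §6.2 (p. 161)]
[cite: Ota2018, Prop. 2.3 (1)] -/
theorem mapRingHom_plusAvatar_eq_family (hℓN : ∀ i, ¬ ℓ i ∣ N)
    (aℓ : ι → ℤ) (ha : ∀ i, cuspCoeff f (ℓ i) = aℓ i)
    (x : CyclotomicField n ℚ) (X : MonoidAlgebra ℚ (ZMod n)ˣ)
    (hxX : x = ∑ g : (ZMod n)ˣ, X.coeff g •
      sigma n g (IsCyclotomicExtension.zeta n ℚ (CyclotomicField n ℚ)))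
    (ιe : CyclotomicField n ℚ →+* ℂ) (u : (ZMod n)ˣ)
    (hι : ιe (IsCyclotomicExtension.zeta n ℚ (CyclotomicField n ℚ)) =
      Complex.exp (2 * Real.pi * Complex.I * ((u : ZMod n).val : ℂ) / n))
    (κ : ℂ) {M : ℕ} (hM0 : M ≠ 0) (hM : M.Coprime n) (c d a : ℤ) (A : ℕ) (d' : ℤ)
    (hval : ∀ {n₀ : ℕ} [NeZero n₀] (hn₀ : n₀ ∣ n) {χ₀ : DirichletCharacter ℂ n₀},
      χ₀.IsPrimitive → χ₀ (-1) = 1 →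
      charSum n ιe (DirichletCharacter.changeLevel hn₀ χ₀) x =
        κ * ((∏ q ∈ (n * M).primeFactors.filter (fun q => ¬ q ∣ n₀),
            (1 - χ₀ (q : ZMod n₀) * cuspCoeff f q * (q : ℂ) ^ (-(1 : ℂ)) +
              (if q ∣ N then 0 else (q : ℂ)) * χ₀ (q : ZMod n₀) ^ 2 * ((q : ℂ) ^ (-(1 : ℂ))) ^ 2)) *
          ((∑ b : ZMod n₀, χ₀⁻¹ b * ((ratPlusSymbol f ((b.val : ℚ) / n₀) : ℚ) : ℂ)) /
            gaussSum χ₀⁻¹ (ZMod.stdAddChar (N := n₀)))) *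
        cuspFactor f true (fun j => (DirichletCharacter.changeLevel hn₀ χ₀)⁻¹ (j : ZMod n)) c d a A d')
    (lam : ι → (ZMod n)ˣ)
    (hlam : ∀ j, ((ZMod.unitsMap (prod_dvd_of_prod_eq ℓ hn (univ.erase j)) (lam j) :
      (ZMod (∏ i ∈ univ.erase j, ℓ i))ˣ) : ZMod (∏ i ∈ univ.erase j, ℓ i)) =
        (ℓ j : ZMod (∏ i ∈ univ.erase j, ℓ i)))
    (Nn e Mt : ι → MonoidAlgebra ℂ (ZMod n)ˣ)
    (hN : ∀ j, Nn j = ∑ h ∈ univ.filter (· ∈ (ZMod.unitsMap (prod_dvd_of_prod_eq ℓ hn (univ.erase j))).ker),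
      single h (1 : ℂ))
    (he : ∀ j, e j = (((ℓ j - 1 : ℕ) : ℂ))⁻¹ • Nn j)
    (Θ : MonoidAlgebra ℂ (ZMod n)ˣ)
    (hΘ : ∀ d : Finset ι,
      haveI : NeZero (∏ i ∈ d, ℓ i) := ⟨Finset.prod_ne_zero_iff.mpr fun i _ => (hℓ i).out.ne_zero⟩
      (∑ g : (ZMod n)ˣ, single g (algebraMap ℚ ℂ (ratPlusSymbol f
          ((((ZMod.unitsMap (prod_dvd_of_prod_eq ℓ hn d) g : (ZMod (∏ i ∈ d, ℓ i))ˣ) :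
            ZMod (∏ i ∈ d, ℓ i)).val : ℚ) / (∏ i ∈ d, ℓ i : ℕ))))) =
        (∏ j ∈ univ \ d, Nn j) * (∏ i ∈ d, (e i * Mt i + (1 - e i))) * Θ)
    (K : ι → MonoidAlgebra ℚ (ZMod n)ˣ)
    (hK : ∀ i, K i = algebraMap ℚ _ (aℓ i : ℚ) - single (lam i)⁻¹ (1 : ℚ) - single (lam i) (ℓ i : ℚ))
    (uq : ℕ → (ZMod n)ˣ) (huq : ∀ q ∈ M.primeFactors, ((uq q : (ZMod n)ˣ) : ZMod n) = q)
    (aM : ℕ → ℤ) (haM : ∀ q ∈ M.primeFactors, cuspCoeff f q = aM q)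
    (E : MonoidAlgebra ℚ (ZMod n)ˣ)
    (hE : E = ∏ q ∈ M.primeFactors, (1 - single (uq q)⁻¹ ((aM q : ℚ) / q) +
      single ((uq q)⁻¹ ^ 2) (if q ∣ N then 0 else (1 / q : ℚ))))
    (uc ud : (ZMod n)ˣ) (huc : (uc : ZMod n) = c) (hud : (ud : ZMod n) = d)
    (C : MonoidAlgebra ℚ (ZMod n)ˣ)
    (hC : C = algebraMap ℚ _ ((c : ℚ) ^ 2 * (d : ℚ) ^ 2 * ratMinusSymbol f ((a : ℚ) / A)) -
      single uc ((c : ℚ) * (d : ℚ) ^ 2 * ratMinusSymbol f ((a * c : ℚ) / A)) -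
      single ud ((c : ℚ) ^ 2 * (d : ℚ) * ratMinusSymbol f ((a * d' : ℚ) / A)) +
      single (uc * ud) ((c : ℚ) * (d : ℚ) * ratMinusSymbol f ((a * c * d' : ℚ) / A))) :
    MonoidAlgebra.mapRingHom (ZMod n)ˣ (algebraMap ℚ ℂ)
        ((n : ℚ) • ((1 + single (-1 : (ZMod n)ˣ) (1 : ℚ)) * X)) =
      (∏ i, (e i * MonoidAlgebra.mapRingHom (ZMod n)ˣ (algebraMap ℚ ℂ) (K i) + (1 - e i))) *
        ((1 + single (-1 : (ZMod n)ˣ) (1 : ℂ)) * single u⁻¹ κ *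
          MonoidAlgebra.mapRingHom (ZMod n)ˣ (algebraMap ℚ ℂ) E *
          MonoidAlgebra.mapRingHom (ZMod n)ˣ (algebraMap ℚ ℂ) C * Θ) := by
  classical
  rw [← sub_eq_zero]
  refine eq_zero_of_forall_lift_eq_zero n _ fun ψ => ?_
  haveI : NeZero ψ.conductor := ⟨ψ.conductor_ne_zero⟩
  have hℓ1 : ∀ j, (((ℓ j - 1 : ℕ)) : ℂ) ≠ 0 := fun j => by
    exact_mod_cast (Nat.sub_pos_of_lt (hℓ j).out.one_lt).ne'
  -- the components of the factors
  have hΘψ := lift_datum_eq_sum_units ℓ hinj hn f Nn e Mt hN he Θ hΘ ψ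
  have heψ : ∀ j, MonoidAlgebra.lift ℂ ℂ (ZMod n)ˣ ((Units.coeHom ℂ).comp ψ.toUnitHom) (e j) =
      if ¬ ℓ j ∣ ψ.conductor then 1 else 0 := fun j => by
    rw [he j, map_smul, hN j, lift_norm_erase_eq ℓ hinj hn j ψ, smul_eq_mul]
    by_cases h : ψ.conductor ∣ ∏ i ∈ univ.erase j, ℓ i
    · rw [if_pos h, if_pos ((dvd_prod_erase_iff_not_dvd ℓ hinj hn ψ.conductor_dvd_level j).mp h),
        inv_mul_cancel₀ (hℓ1 j)]
    · rw [if_neg h, if_neg (fun h' => h ((dvd_prod_erase_iff_not_dvd ℓ hinj hn ψ.conductor_dvd_level j).mpr h')),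
        mul_zero]
  have hfac : ∀ i, MonoidAlgebra.lift ℂ ℂ (ZMod n)ˣ ((Units.coeHom ℂ).comp ψ.toUnitHom)
      (e i * MonoidAlgebra.mapRingHom (ZMod n)ˣ (algebraMap ℚ ℂ) (K i) + (1 - e i)) =
      if ¬ ℓ i ∣ ψ.conductor then
        (aℓ i : ℂ) - (ψ.primitiveCharacter)⁻¹ (ℓ i : ZMod ψ.conductor) -
          (ℓ i : ℂ) * ψ.primitiveCharacter (ℓ i : ZMod ψ.conductor) else 1 := fun i => by
    rw [lift_localFactor_eq _ (e i) _ (¬ ℓ i ∣ ψ.conductor) (heψ i), lift_mapRingHom_algebraMap]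
    by_cases h : ¬ ℓ i ∣ ψ.conductor
    · rw [if_pos h, if_pos h, liftQ_katoFactor_eq ψ ℓ hn i
        ((dvd_prod_erase_iff_not_dvd ℓ hinj hn ψ.conductor_dvd_level i).mpr h) (lam i) (hlam i) (aℓ i)
        (K i) (hK i)]
    · rw [if_neg h, if_neg h]
  rw [map_sub, sub_eq_zero, lift_mapRingHom_algebraMap, map_smul, Rat.smul_def, Rat.cast_natCast, map_mul,
    liftQ_one_add_single_neg_one, map_mul, map_prod, map_mul, map_mul, map_mul, map_mul,
    lift_one_add_single_neg_one, lift_single_coeHom, lift_mapRingHom_algebraMap, lift_mapRingHom_algebraMap,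
    liftQ_depletion_eq ψ f hM uq huq aM haM E hE, liftQ_cusp_eq ψ f c d a A d' uc ud huc hud C hC, hΘψ]
  simp_rw [hfac]
  rcases ψ.even_or_odd with heven | hodd
  · -- even characters: `2 ×` the identity `lift_avatar_eq_of_even`
    have heven1 : ψ (-1) = 1 := heven
    have hmain := lift_avatar_eq_of_even ℓ hinj hn f hℓN x X hxX ιe u hι κ hM0 hM c d a A d' hval ψ heven
    have hprodK : (∏ i, if ¬ ℓ i ∣ ψ.conductor then
        (aℓ i : ℂ) - (ψ.primitiveCharacter)⁻¹ (ℓ i : ZMod ψ.conductor) -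
          (ℓ i : ℂ) * ψ.primitiveCharacter (ℓ i : ZMod ψ.conductor) else 1) =
        ∏ i ∈ univ.filter (fun i => ¬ ℓ i ∣ ψ.conductor),
          (cuspCoeff f (ℓ i) - (ψ.primitiveCharacter)⁻¹ (ℓ i : ZMod ψ.conductor) -
            (ℓ i : ℂ) * ψ.primitiveCharacter (ℓ i : ZMod ψ.conductor)) := by
      rw [Finset.prod_filter]
      exact Finset.prod_congr rfl fun i _ => by rw [ha i]
    have hS : (∑ b : (ZMod ψ.conductor)ˣ, algebraMap ℚ ℂ (ratPlusSymbol f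
        (((b : ZMod ψ.conductor).val : ℚ) / ψ.conductor)) * ψ.primitiveCharacter (b : ZMod ψ.conductor)) =
        ∑ b : ZMod ψ.conductor, ψ.primitiveCharacter b *
          ((ratPlusSymbol f ((b.val : ℚ) / ψ.conductor) : ℚ) : ℂ) := by
      rw [sum_mul_eq_sum_units_mul]
      exact Finset.sum_congr rfl fun b _ => by rw [eq_ratCast, mul_comm]
    rw [heven1, hprodK, hS]
    linear_combination (1 + 1) * hmain
  · -- odd characters: both sides vanish
    have hodd1 : ψ (-1) = -1 := hodd
    rw [hodd1]
    ring

end Avatar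

end EulerFactorComparison

end Summit.BirchSwinnertonDyer.Rank1Residual.GaloisImage

end
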